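import Literature.IUT.HodgeArakelov.MonoThetaProjectiveThetaEnvProofs
import Literature.IUT.HodgeArakelov.MonoThetaCor110SubdagStatements

/-!
# [IUTchII] Cor. 1.10 at the GENUINE natural system, I: the `Π_X(𝕄_*)`-module structures on `(l·Δ_Θ)(𝕄_*)` and
# `Π_μ(𝕄_*)` and (∗mono-Θ) as an equivariant isomorphism (sub-DAG row C110-S8 at the natural system)

S. Mochizuki, *Inter-universal Teichmüller theory II*, §1, Cor. 1.10, kurims p. 47 l. 7–19 (VERBATIM, own fetch
paper:url-5036b4059555 p0047): "Consider the cyclotomic rigidity isomorphism `(l·Δ_Θ)(Π) ⥲ Π_μ(M^Θ_*(Π))` (∗mono-Θ_Π) [where we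
identify `(l·Δ_Θ)(M^Θ_*(Π))` with `(l·Δ_Θ)(Π)` — cf. Proposition 1.4] obtained by composing the functorial algorithm `Π ↦ M^Θ_*(Π)`
of Proposition 1.2, (i) [cf. also Proposition 1.5, (i)], with the functorial algorithm for constructing a cyclotomic rigidity
isomorphism of Proposition 1.5, (iii). Then the data consisting of the topological group `Π`, the topological `Π`-modules
constituted by the domain and codomain of (∗mono-Θ_Π), and the isomorphism (∗mono-Θ_Π) determines a functor `ℛ → ℱ` [i.e., where `ℱ`
denotes the category defined in the evident way so as to accommodate the data just listed] which arises from a functorial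
algorithm in the topological group `Π`; … In particular, the resulting natural functor `Ψ_ℛ : ℛ → ℛ†` [cf. Example 1.9, (i)] is
multiradially defined."
[claim: Mochizuki2012, status: disputed] (IUTchII §1 Cor 1.10, kurims p.47); Def. 1.1 (i) p. 21 ("`(l·Δ_Θ)(M)`
… admits a natural `Π_X(M)`-action", "`Π_μ(M)` … admits a natural `Π_X(M)`-action"); [EtTh] Cor. 2.19 (i) p. 290 (PRIMS PDF
p. 64) [cite: MochizukiEtTh2009, Cor 2.19(i) p.64].

abc-iut cell (WAVE-4 seat abc-iut-w4-d038, gen 2), sub-DAG `plan/L6/SUBDAG-IUTchII-Cor-110.md` row **C110-S8** at the GENUINE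
natural projective system of model mono-theta environments of `X̲̲_K` over `ℕ_{≥1}` (abc-iut-w4-d030's `EtaleLevels.modelSystem`,
p414139, with `θ_env` data `EtaleLevels.thetaEnvData`, p415224, whose limit cyclotomic rigidity is an isomorphism by
`EtaleLevels.bijective_rigidLimHom`, p416249). Companion (part I) of `ModelMonoThetaBaseDatumLim.lean` (part II: the base datum
with its `Aut(Π^tp_{X̲̲})`-action, the functorial family, and the junction C110-S10). DATA definitions (no `Prop`-valued
definition, no new named fact), every law PROVED:
* `EtaleLevels.actIntLim` — the `Π^tp_{X̲̲}`-action on `(l·Δ_Θ)(𝕄_*) = (l·Δ_Θ)/thetaKer` (conjugation, descended: abc-iut-L6-d6's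
  `SubquotientKit.conjQuot`); `intCompat_actIntLim` — through `intCompat M` it IS the Def. 1.1 (i) action `intAct` of `𝕄_M`;
* `EtaleLevels.rigidLimEquiv` — (∗mono-Θ) `(l·Δ_Θ)(𝕄_*) ⥲ Π_μ(𝕄_*)` as an isomorphism (`rigidLimHom` + `bijective_rigidLimHom`);
  `intLim` / `extLim` — both sides bundled as COMMUTATIVE groups (commutativity from `hZ : (l·Δ_Θ)/thetaKer ≅ Ẑ`, transported);
* `EtaleLevels.actExtLim` — the `Π^tp_{X̲̲}`-action on `Π_μ(𝕄_*)` (transport through (∗mono-Θ)); `actExtLim_level` — coordinatewise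
  it IS the Def. 1.1 (i) action `extAct` of `𝕄_M` (cyclotomic character on `μ_M`), by the mod-`M` equivariance
  `CyclotomicRigidity.equivariant` of abc-iut-L6-d6's model rigidity isomorphism;
* **`EtaleLevels.moduleStrLim : (thetaEnvData …).ModuleStr`** — abc-iut-w5-d145's C110-S8 structure INHABITED at the genuine system
  (both pinning laws PROVED), and `rigidLim_equivariant_lim` — (∗mono-Θ) is `Π_X(𝕄_*)`-equivariant (C110-S9 instantiated).
Binders: the natural system's (`C hC hS hl hp2 hpl hζ mods f hf hmods`, `Prop15iii` (h15), `CuspLabels` (L), `hZ` = GAP G-w4d021-1,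
itself abc-iut-L2-d1's theorem modulo `IsEtThOrigin` + G-w4d021-2) and, for `thetaEnvData`, `PiYddCharacteristic C` (the
`Π^tp_{Ÿ}`-clause of [EtTh] Cor. 2.18 (i)). HONEST FRAMING: constructions over the cell's own [EtTh]-side objects; the [IUTchII] side is
the claim key `Mochizuki2012` (DISPUTED, D-0012) and nothing disputed is asserted; no side is taken on [IUTchIII] Cor. 3.12;
typed ≠ discharged.
v2 (doc-only, referee lane O finding O14-F1, 2026-08-26): the header quotation of Cor. 1.10 is now VERBATIM (v1 paraphrased the
«obtained by composing …» clause inside quotation marks); no declaration changed.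
-/

noncomputable section

namespace Literature.IUT.HodgeArakelov

open CategoryTheory Literature.AnabelianGeometry.EtaleTheta Literature.AnabelianGeometry.SemiGraphs
open scoped Literature.AnabelianGeometry.EtaleTheta

namespace EtaleLevels

variable {p : ℕ} [Fact p.Prime] {D : Literature.AnabelianGeometry.EtaleTheta.ThetaSetting p}
  {E : D.EtaleThetaData} {l : ℕ} (C : E.DoubleUnderline l) (hC : D.Compat) (hS : D.Sec2Hyps)
  (hl : l.Prime) (hp2 : p ≠ 2) (hpl : p ≠ l) (hζ : ∃ ζ : D.K, IsPrimitiveRoot ζ (4 * l))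
  (mods : ∀ M : ℕ+, D.CyclotomeMod l M)
  (f : contCocycles D.toTheta D.DeltaTheta C.GtpYdduu) (hf : f ∈ C.rootCocycles hC)
  (hmods : ∀ (M M' : ℕ+) (h : (M : ℕ) ∣ (M' : ℕ)) (x : D.lDeltaTheta l),
    MuN.red p M M' h ((mods M').red x) = (mods M).red x)
  (h15 : Literature.AnabelianGeometry.EtaleTheta.ThetaSetting.Prop15iii E hC) (L : C.CuspLabels)
  (hZ : ∀ M : ℕ+, Nonempty (ModelCyclotomes.lDeltaQuot (C.rigidData (mods M) hC hS h15 L) ≃*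
    Literature.IUT.HodgeTheaters.ZHat))
  (hcharY : EtaleThetaDataOfSetting.PiYddCharacteristic C)

/-! ## The level rigidity data (bookkeeping) -/

/-- abc-iut-L2-t8's rigidity data of `X̲̲_K` at level `M` (reducible shorthand; its `thetaKer`, the inverse image of
`l·Δ_Θ` and `Π^tp_{X̲̲}` do NOT depend on `M`). [cite: MochizukiEtTh2009, Cor 2.18 p.59] -/
abbrev levelRigid (M : ℕ+) : RigidData.{0} M l := C.rigidData (mods M) hC hS h15 L

/-! ## C110-S8, interior side: `(l·Δ_Θ)(𝕄_*)` as a commutative `Π^tp_{X̲̲}`-module -/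

include hZ in
/-- `(l·Δ_Θ)(𝕄_*)` is commutative (it is abstractly `≅ Ẑ` by `hZ`). Explicit structure term, no instance declared.
[claim: Mochizuki2012, status: disputed] (IUTchII §1 Def 1.1 (i), kurims p.21) -/
theorem intLim_mul_comm (a b : (EtaleThetaDataOfSetting.lDeltaSubquotient C).carrier) : a * b = b * a := by
  have e : (EtaleThetaDataOfSetting.lDeltaSubquotient C).carrier ≃* Literature.IUT.HodgeTheaters.ZHat := (hZ 1).some
  exact e.injective (by rw [map_mul, map_mul, Literature.IUT.HodgeTheaters.ZHat.mul_comm])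

/-- `(l·Δ_Θ)(𝕄_*)` as a commutative group (structure term). [claim: Mochizuki2012, status: disputed] (IUTchII §1 Def 1.1 (i), kurims p.21) -/
@[reducible] def commGroupIntLim : CommGroup (EtaleThetaDataOfSetting.lDeltaSubquotient C).carrier :=
  { (inferInstance : Group (EtaleThetaDataOfSetting.lDeltaSubquotient C).carrier) with
    mul_comm := intLim_mul_comm C hC hS mods h15 L hZ }

/-- `(l·Δ_Θ)(𝕄_*)`, bundled. [claim: Mochizuki2012, status: disputed] (IUTchII §1 Def 1.1 (i), kurims p.21) -/
def intLim : CommGrpCat.{0} :=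
  @CommGrpCat.mk (EtaleThetaDataOfSetting.lDeltaSubquotient C).carrier (commGroupIntLim C hC hS mods h15 L hZ)

/-- **The `Π^tp_{X̲̲}`-action on `(l·Δ_Θ)(𝕄_*) = (l·Δ_Θ)/thetaKer`**: conjugation, descended ([IUTchII] Def. 1.1 (i) "admits a
natural `Π_X(M)`-action"; abc-iut-L6-d6's `SubquotientKit.conjQuot`). [claim: Mochizuki2012, status: disputed] (IUTchII §1 Def 1.1 (i), kurims p.21) -/
def actIntLim : ↥C.Huu →* MulAut (EtaleThetaDataOfSetting.lDeltaSubquotient C).carrier :=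
  SubquotientKit.conjQuot (levelRigid C hC hS mods h15 L 1).lDeltaTheta (levelRigid C hC hS mods h15 L 1).thetaKer

/-- The interior action at any level's vocabulary is the same map (the subgroups do not depend on the level).
[claim: Mochizuki2012, status: disputed] (IUTchII §1 Def 1.1 (i), kurims p.21) -/
theorem actIntLim_eq_conjQuot (M : ℕ+) (x : ↥C.Huu) (a : (EtaleThetaDataOfSetting.lDeltaSubquotient C).carrier) :
    actIntLim C hC hS mods h15 L x a =
      SubquotientKit.conjQuot (levelRigid C hC hS mods h15 L M).lDeltaTheta (levelRigid C hC hS mods h15 L M).thetaKer x a :=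
  rfl

/-- **Through `intCompat M`, the interior action IS the Def. 1.1 (i) action `intAct` of the member `𝕄_M`** (the
`ModuleStr.actInt_level` law, PROVED). [claim: Mochizuki2012, status: disputed] (IUTchII §1 Cor 1.10, kurims p.47) -/
theorem intCompat_actIntLim (M : ℕ+) (x : ↥C.Huu) (a : (EtaleThetaDataOfSetting.lDeltaSubquotient C).carrier)
    (c : (ModelCyclotomes.intCyc (levelRigid C hC hS mods h15 L M)).carrier)
    (hc : intCompat C hC hS mods h15 L M a = QuotientGroup.mk c) :
    intCompat C hC hS mods h15 L M (actIntLim C hC hS mods h15 L x a) =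
      QuotientGroup.mk (ModelCyclotomes.intAct (levelRigid C hC hS mods h15 L M) x c) := by
  have h1 : (ModelCyclotomes.intCycEquiv (levelRigid C hC hS mods h15 L M)).symm (actIntLim C hC hS mods h15 L x a) =
      ModelCyclotomes.intAct (levelRigid C hC hS mods h15 L M) x
        ((ModelCyclotomes.intCycEquiv (levelRigid C hC hS mods h15 L M)).symm a) := by
    apply (ModelCyclotomes.intCycEquiv (levelRigid C hC hS mods h15 L M)).injective
    rw [MulEquiv.apply_symm_apply, ModelCyclotomes.intCycEquiv_intAct, MulEquiv.apply_symm_apply]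
    rfl
  have hc' : (QuotientGroup.mk ((ModelCyclotomes.intCycEquiv (levelRigid C hC hS mods h15 L M)).symm a) :
      ModPow (ModelCyclotomes.intCyc (levelRigid C hC hS mods h15 L M)).carrier (M : ℕ)) = QuotientGroup.mk c := hc
  change (QuotientGroup.mk ((ModelCyclotomes.intCycEquiv (levelRigid C hC hS mods h15 L M)).symm
      (actIntLim C hC hS mods h15 L x a)) : ModPow _ (M : ℕ)) = _
  rw [h1]
  calc (QuotientGroup.mk (ModelCyclotomes.intAct (levelRigid C hC hS mods h15 L M) x
          ((ModelCyclotomes.intCycEquiv (levelRigid C hC hS mods h15 L M)).symm a)) : ModPow _ (M : ℕ))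
      = ModelCyclotomes.modPowCongr (ModelCyclotomes.intAct (levelRigid C hC hS mods h15 L M) x) (M : ℕ)
          (QuotientGroup.mk ((ModelCyclotomes.intCycEquiv (levelRigid C hC hS mods h15 L M)).symm a)) :=
        (ModelCyclotomes.modPowCongr_mk _ _ _).symm
    _ = ModelCyclotomes.modPowCongr (ModelCyclotomes.intAct (levelRigid C hC hS mods h15 L M) x) (M : ℕ)
          (QuotientGroup.mk c) := by rw [hc']
    _ = QuotientGroup.mk (ModelCyclotomes.intAct (levelRigid C hC hS mods h15 L M) x c) :=
        ModelCyclotomes.modPowCongr_mk _ _ _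

/-! ## C110-S8, exterior side: `Π_μ(𝕄_*)` and THE limit cyclotomic rigidity isomorphism -/

/-- **(∗mono-Θ) at the genuine natural system**: the limit cyclotomic rigidity map `(l·Δ_Θ)(𝕄_*) → Π_μ(𝕄_*)` of
abc-iut-w4-d030 (`rigidLimHom`, p415224) as an ISOMORPHISM (bijective by `bijective_rigidLimHom`, p416249) — literally the
field `rigidLim` of `thetaEnvData … (bijective_rigidLimHom …)`. [claim: Mochizuki2012, status: disputed] (IUTchII §1 Prop 1.5 (iii), kurims p.29) -/
def rigidLimEquiv :
    (EtaleThetaDataOfSetting.lDeltaSubquotient C).carrier ≃*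
      ↥(modelSystem C hC hS hl hp2 hpl hζ mods f hf hmods h15 L hZ).extCycLim :=
  MulEquiv.ofBijective (rigidLimHom C hC hS hl hp2 hpl hζ mods f hf hmods h15 L hZ)
    (bijective_rigidLimHom C hC hS hl hp2 hpl hζ mods f hf hmods h15 L hZ)

/-- `rigidLimEquiv` is `rigidLimHom` on elements. [claim: Mochizuki2012, status: disputed] (IUTchII §1 Prop 1.5 (iii), kurims p.29) -/
@[simp] theorem rigidLimEquiv_apply (a : (EtaleThetaDataOfSetting.lDeltaSubquotient C).carrier) :
    rigidLimEquiv C hC hS hl hp2 hpl hζ mods f hf hmods h15 L hZ a =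
      rigidLimHom C hC hS hl hp2 hpl hζ mods f hf hmods h15 L hZ a :=
  rfl

include hmods in
/-- `Π_μ(𝕄_*)` is commutative (it is `≅ (l·Δ_Θ)(𝕄_*)` by (∗mono-Θ)). [claim: Mochizuki2012, status: disputed] (IUTchII §1 Prop 1.5 (iii), kurims p.29) -/
theorem extLim_mul_comm (y z : ↥(modelSystem C hC hS hl hp2 hpl hζ mods f hf hmods h15 L hZ).extCycLim) :
    y * z = z * y := by
  obtain ⟨a, rfl⟩ := (rigidLimEquiv C hC hS hl hp2 hpl hζ mods f hf hmods h15 L hZ).surjective y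
  obtain ⟨b, rfl⟩ := (rigidLimEquiv C hC hS hl hp2 hpl hζ mods f hf hmods h15 L hZ).surjective z
  rw [← map_mul, ← map_mul, intLim_mul_comm C hC hS mods h15 L hZ a b]

/-- `Π_μ(𝕄_*)` as a commutative group (structure term). [claim: Mochizuki2012, status: disputed] (IUTchII §1 Prop 1.5 (iii), kurims p.29) -/
@[reducible] def commGroupExtLim : CommGroup ↥(modelSystem C hC hS hl hp2 hpl hζ mods f hf hmods h15 L hZ).extCycLim :=
  { (inferInstance : Group ↥(modelSystem C hC hS hl hp2 hpl hζ mods f hf hmods h15 L hZ).extCycLim) with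
    mul_comm := extLim_mul_comm C hC hS hl hp2 hpl hζ mods f hf hmods h15 L hZ }

/-- `Π_μ(𝕄_*)`, bundled. [claim: Mochizuki2012, status: disputed] (IUTchII §1 Prop 1.5 (iii), kurims p.29) -/
def extLim : CommGrpCat.{0} :=
  @CommGrpCat.mk (↥(modelSystem C hC hS hl hp2 hpl hζ mods f hf hmods h15 L hZ).extCycLim)
    (commGroupExtLim C hC hS hl hp2 hpl hζ mods f hf hmods h15 L hZ)

/-- **The `Π^tp_{X̲̲}`-action on `Π_μ(𝕄_*)`**, DEFINED by transport of the interior action through (∗mono-Θ) and PROVED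
below (`actExtLim_level`) to be, coordinatewise, the Def. 1.1 (i) action `extAct` of each member `𝕄_M` (the cyclotomic
character on `μ_M ⊆ Π^tp_{Y̲̲}[μ_M]`). [claim: Mochizuki2012, status: disputed] (IUTchII §1 Def 1.1 (i), kurims p.21) -/
def actExtLim : ↥C.Huu →* MulAut ↥(modelSystem C hC hS hl hp2 hpl hζ mods f hf hmods h15 L hZ).extCycLim :=
  (MulAut.congr (rigidLimEquiv C hC hS hl hp2 hpl hζ mods f hf hmods h15 L hZ)).toMonoidHom.comp
    (actIntLim C hC hS mods h15 L)

/-- `actExtLim x = (∗mono-Θ) ∘ actIntLim x ∘ (∗mono-Θ)⁻¹` on elements. [claim: Mochizuki2012, status: disputed] (IUTchII §1 Def 1.1 (i), kurims p.21) -/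
theorem actExtLim_apply (x : ↥C.Huu) (y : ↥(modelSystem C hC hS hl hp2 hpl hζ mods f hf hmods h15 L hZ).extCycLim) :
    actExtLim C hC hS hl hp2 hpl hζ mods f hf hmods h15 L hZ x y =
      rigidLimEquiv C hC hS hl hp2 hpl hζ mods f hf hmods h15 L hZ
        (actIntLim C hC hS mods h15 L x ((rigidLimEquiv C hC hS hl hp2 hpl hζ mods f hf hmods h15 L hZ).symm y)) :=
  rfl

/-- **Coordinatewise, the exterior action IS the Def. 1.1 (i) action `extAct` of the member `𝕄_M`** (the
`ModuleStr.actExt_level` law, PROVED from the mod-`M` equivariance `CyclotomicRigidity.equivariant` of abc-iut-L6-d6's model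
rigidity isomorphism and `intCompat_actIntLim`). [claim: Mochizuki2012, status: disputed] (IUTchII §1 Cor 1.10, kurims p.47) -/
theorem actExtLim_level (M : ℕ+) (x : ↥C.Huu)
    (y : ↥(modelSystem C hC hS hl hp2 hpl hζ mods f hf hmods h15 L hZ).extCycLim) :
    ((actExtLim C hC hS hl hp2 hpl hζ mods f hf hmods h15 L hZ x y :
        ↥(modelSystem C hC hS hl hp2 hpl hζ mods f hf hmods h15 L hZ).extCycLim) :
        ∀ M', ((modelSystem C hC hS hl hp2 hpl hζ mods f hf hmods h15 L hZ).env M').Pi) M =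
      (((modelRecon C hC hS hl hp2 hpl hζ mods f hf h15 L hZ M).extAct x
          ⟨(y : ∀ M', ((modelSystem C hC hS hl hp2 hpl hζ mods f hf hmods h15 L hZ).env M').Pi) M, y.2.1 M⟩ :
          (modelRecon C hC hS hl hp2 hpl hζ mods f hf h15 L hZ M).extCyc) :
        ((modelFamily C hC hS hl hp2 hpl hζ mods f hf).modelEnv M).Pi) := by
  obtain ⟨a, rfl⟩ := (rigidLimEquiv C hC hS hl hp2 hpl hζ mods f hf hmods h15 L hZ).surjective y
  rw [actExtLim_apply, MulEquiv.symm_apply_apply]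
  have h2 : (⟨((rigidLimEquiv C hC hS hl hp2 hpl hζ mods f hf hmods h15 L hZ a :
        ↥(modelSystem C hC hS hl hp2 hpl hζ mods f hf hmods h15 L hZ).extCycLim) :
        ∀ M', ((modelSystem C hC hS hl hp2 hpl hζ mods f hf hmods h15 L hZ).env M').Pi) M,
        (rigidLimEquiv C hC hS hl hp2 hpl hζ mods f hf hmods h15 L hZ a).2.1 M⟩ :
        (modelRecon C hC hS hl hp2 hpl hζ mods f hf h15 L hZ M).extCyc) =
      (rigid C hC hS hl hp2 hpl hζ mods f hf h15 L hZ M).iso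
        (QuotientGroup.mk ((ModelCyclotomes.intCycEquiv (levelRigid C hC hS mods h15 L M)).symm a)) :=
    rfl
  rw [h2, ← (rigid C hC hS hl hp2 hpl hζ mods f hf h15 L hZ M).equivariant x]
  change ((rigid C hC hS hl hp2 hpl hζ mods f hf h15 L hZ M).iso
      (intCompat C hC hS mods h15 L M (actIntLim C hC hS mods h15 L x a))).val = _
  rw [intCompat_actIntLim C hC hS mods h15 L M x a _ rfl]
  rfl

/-! ## C110-S8: the module structures of the genuine `θ_env` data -/

/-- **IUTchII:Cor1.10, sub-node C110-S8 AT THE GENUINE NATURAL SYSTEM**: the `Π_X(𝕄_*) = Π^tp_{X̲̲}`-module structures on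
the domain `(l·Δ_Θ)(𝕄_*)` and the codomain `Π_μ(𝕄_*)` of (∗mono-Θ) (abc-iut-w5-d145's `ThetaEnvData.ModuleStr`), for
abc-iut-w4-d030's `θ_env` data `thetaEnvData` (with the limit rigidity an isomorphism by `bijective_rigidLimHom`): both
PINNING laws PROVED (`intCompat_actIntLim`, `actExtLim_level`). [claim: Mochizuki2012, status: disputed] (IUTchII §1 Cor 1.10, kurims p.47) -/
def moduleStrLim :
    (thetaEnvData C hC hS hl hp2 hpl hζ mods f hf hmods h15 L hZ hcharY
      (bijective_rigidLimHom C hC hS hl hp2 hpl hζ mods f hf hmods h15 L hZ)).ModuleStr where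
  actInt := actIntLim C hC hS mods h15 L
  actExt := actExtLim C hC hS hl hp2 hpl hζ mods f hf hmods h15 L hZ
  actExt_level M xM y := actExtLim_level C hC hS hl hp2 hpl hζ mods f hf hmods h15 L hZ M xM y
  actInt_level M xM a c hc := intCompat_actIntLim C hC hS mods h15 L M xM a c hc

include hcharY hmods in
/-- (∗mono-Θ) is `Π_X(𝕄_*)`-equivariant for these module structures (abc-iut-w5-d145's `rigidLim_equivariant_of_surjective`;
the transitions on `Π_X` are identities here). [claim: Mochizuki2012, status: disputed] (IUTchII §1 Cor 1.10, kurims p.47) -/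
theorem rigidLim_equivariant_lim (x : ↥C.Huu) (a : (EtaleThetaDataOfSetting.lDeltaSubquotient C).carrier) :
    (thetaEnvData C hC hS hl hp2 hpl hζ mods f hf hmods h15 L hZ hcharY
        (bijective_rigidLimHom C hC hS hl hp2 hpl hζ mods f hf hmods h15 L hZ)).rigidLim
        (actIntLim C hC hS mods h15 L x a) =
      actExtLim C hC hS hl hp2 hpl hζ mods f hf hmods h15 L hZ x
        ((thetaEnvData C hC hS hl hp2 hpl hζ mods f hf hmods h15 L hZ hcharY
          (bijective_rigidLimHom C hC hS hl hp2 hpl hζ mods f hf hmods h15 L hZ)).rigidLim a) :=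
  ThetaEnvData.rigidLim_equivariant_of_surjective _ (moduleStrLim C hC hS hl hp2 hpl hζ mods f hf hmods h15 L hZ hcharY)
    (fun _ x => ⟨x, rfl⟩) x a

end EtaleLevels

end Literature.IUT.HodgeArakelov
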